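import Mathlib
import HarnessLib
import Literature.Analysis.FluidPDE.SuitableWeak
import Literature.Analysis.FluidPDE.SelfSimilar
import Literature.Analysis.FluidPDE.LocalTypeI
import Literature.Analysis.FluidPDE.ESSLocalHolderNoConcentration
import Summits.NavierStokesRegularity.NavierStokesRegularity.Theorems.RellichScarNoMildScar
import Summits.NavierStokesRegularity.NavierStokesRegularity.Theorems.RellichScarApexLocalisationHalfspaceZoomLimit
import Summits.NavierStokesRegularity.NavierStokesRegularity.Theorems.RellichScarApexLocalisationHalfspaceFarFieldCurl
import Summits.NavierStokesRegularity.NavierStokesRegularity.Theorems.RellichScarApexLocalisationHalfspaceFarFieldRepresentative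
import Summits.NavierStokesRegularity.NavierStokesRegularity.Theorems.RellichScarApexLocalisationHalfspaceStripLiouville

/-!
# The half-space Liouville theorem for rate-Type-I slab profiles (line calm-cone-carleman, crux
# ApexLocalisation stmt-NavierStokesRegularity-11719, stub `stub_halfspaceLiouville` = K1)

**Theorem (K1, half-space case of the card's `TracelessConeLiouville`).** A suitable weak solution of
Navier–Stokes on the backward slab `(-∞,0) × ℝ³` with a weak gradient, Albritton–Barker quantity `𝐈 < ⊤`
and the Type-I RATE `‖u(t,x)‖ ≤ C/√(−t)`, which on an open half-space `{⟪x,e⟫ > 0}` through the origin is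
apex-CALM (`‖u(t,x)‖ ≤ K/(‖x‖ + √(−t))`) and scar-FAINT (`‖x‖‖u(t,x)‖ ≤ ε` for `⟪x,e⟫ > 0`, `‖x‖ < δ(ε)`,
`−η(ε)‖x‖² < t < 0`), is NOT singular at the space–time origin.  In words: at a Type-I singular point the
profile cannot be both apex-bounded and traceless on a whole half-space — singular points of the rate class
have no "clean side".  This is new only as a COMBINATION of known theorems; every analytic input is in the
tree: the slab compactness engine (Albritton–Barker 2019), Serrin's higher regularity with constants,
Escauriaza–Seregin–Šverák's backward uniqueness across half-spaces (Thm. 5.1, proved in the tree) and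
unique continuation (Thm. 4.1), the bounded div–curl Liouville theorem and the Morrey bound `A ≤ 𝐈`.

Proof = composition of the four landed stubs of the line:
S1 `stub_halfspaceZoomLimit` (blow-up at the origin; rate/calm/faint pass to the limit a.e.),
S3 `stub_halfspaceFarFieldRepresentative` (smooth far-field representative on `{⟪x,e⟫ > R₀+1}`, `R₀ = max K 1`,
weak top vanishing of the cut-off field), S2 `stub_halfspaceFarFieldCurl` (far-field vorticity vanishes across
the translated half-space `(R₀+1)e + {⟪y,e⟫ > 0}`), S4 `stub_halfspaceStripLiouville` (slices vanish on every
strip `]-1/3, -1/(n+4)[`, the rate bounding the velocity there); hence the limit vanishes a.e. on `Q(0, 1/2)`,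
contradicting the persistence of the singular origin.

References: Escauriaza–Seregin–Šverák 2003 (Thm. 1.4 scheme, Thms. 4.1, 5.1); Albritton–Barker 2019 =
arXiv:1811.00502 (Lemma 2.2, Prop. 2.3, §3); KNSS 2009 (Lemma 3.1); Seregin 2014, §6.6; card
`Cruxes/ApexLocalisation/Ideas/calm-cone-carleman.md` (K1).
-/

noncomputable section

set_option linter.dupNamespace false

namespace Summit.NavierStokesRegularity.NavierStokesRegularity.Theorems.RellichScarApexLocalisation

open MeasureTheory Set Function Metric Filter Topology TopologicalSpace
open scoped ENNReal NNReal InnerProductSpace RealInnerProductSpace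
open Literature.Analysis Literature.Analysis.FluidPDE

local notation "E³" => EuclideanSpace ℝ (Fin 3)

/-- The open backward slab `(-∞, 0) × ℝ³` (time first). -/
local notation "𝕊" => Literature.Analysis.FluidPDE.slab (EuclideanSpace ℝ (Fin 3)) (Set.Iio (0 : ℝ)) isOpen_Iio

/-- **S5 (stub_halfspaceLiouville) — K1, `TracelessConeLiouville` in the half-space case.** A suitable weak solution
of Navier–Stokes on the backward slab with a weak gradient, `𝐈 < ⊤` and the Type-I RATE `‖u(t,x)‖ ≤ C/√(−t)`, which
on an open half-space `{⟪x,e⟫ > 0}` through the origin is apex-CALM (`‖u(t,x)‖ ≤ K/(‖x‖ + √(−t))`) and scar-FAINT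
(`‖x‖‖u(t,x)‖ ≤ ε` for `⟪x,e⟫ > 0`, `‖x‖ < δ`, `−η‖x‖² < t < 0`), is NOT singular at the origin.  Proof: the blow-up
limit at the origin (S1) is `≤ 1` and uniformly small near the top on a far half-space, so its far-field vorticity
vanishes there (S3), hence its slices vanish on every strip below the final time (S4, the rate bounding the strips), so
the limit vanishes on `Q(0, 1/2)` — but it is singular at the origin. [cite: EscauriazaSereginSverak2003, Thm. 1.4 and §3] -/
theorem stub_halfspaceLiouville :
    ∀ (C K : ℝ) (e : E³), ‖e‖ = 1 →
      ∀ (u : ℝ → E³ → E³) (p : ℝ → E³ → ℝ) (G : ℝ → E³ → E³ →L[ℝ] E³),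
      IsSuitableWeakSolutionOn 𝕊 1 0 u p → HasWeakSpatialGradientOn 𝕊 u G →
      typeIBound (Iio (0 : ℝ) ×ˢ univ) u p G < ⊤ → HasTypeITimeDecay C u →
      (∀ t : ℝ, t < 0 → ∀ x : E³, 0 < ⟪x, e⟫ → ‖u t x‖ ≤ K / (‖x‖ + Real.sqrt (-t))) →
      (∀ ε : ℝ, 0 < ε → ∃ δ : ℝ, 0 < δ ∧ ∃ η : ℝ, 0 < η ∧ ∀ x : E³, 0 < ⟪x, e⟫ → ‖x‖ < δ →
        ∀ t : ℝ, -η * ‖x‖ ^ 2 < t → t < 0 → ‖x‖ * ‖u t x‖ ≤ ε) →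
      ¬ IsBackwardSingularPoint u 0 := by
  intro C K e he u p G hsw hwg hI hrate hcalm hfaint hsing
  -- ## S1: blow-up at the origin
  obtain ⟨w, π, H, hsww, hH, hIw, hsingw, hratew, hcalmw, hfaintw⟩ :=
    stub_halfspaceZoomLimit C K e u p G hsw hwg hI hrate hsing hcalm hfaint
  have hSo : ∀ R : ℝ, IsOpen {x : E³ | R < ⟪x, e⟫} := fun R =>
    isOpen_lt continuous_const (continuous_id.inner continuous_const)
  have hSm : ∀ R : ℝ, MeasurableSet {x : E³ | R < ⟪x, e⟫} := fun R => (hSo R).measurableSet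
  have hinner : ∀ x : E³, ⟪x, e⟫ ≤ ‖x‖ := fun x => by
    have h := real_inner_le_norm x e
    rwa [he, mul_one] at h
  -- ## the far half-space `{⟪x, e⟫ > R₀}`: `|w| ≤ 1` and uniform smallness near the top
  set R₀ : ℝ := max K 1 with hR₀def
  have hR₀ : 0 < R₀ := lt_of_lt_of_le one_pos (le_max_right _ _)
  have hfar : ∀ᵐ z ∂(volume.restrict (Ioo (-2 : ℝ) 0 ×ˢ {x : E³ | R₀ < ⟪x, e⟫})), ‖w z.1 z.2‖ ≤ 1 := by
    have hsub : Ioo (-2 : ℝ) 0 ×ˢ {x : E³ | R₀ < ⟪x, e⟫} ⊆ Iio (0 : ℝ) ×ˢ (univ : Set E³) :=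
      prod_mono Ioo_subset_Iio_self (subset_univ _)
    filter_upwards [ae_restrict_of_ae_restrict_of_subset hsub hcalmw,
      ae_restrict_mem (measurableSet_Ioo.prod (hSm R₀))] with z hz hzmem
    have hxe : R₀ < ⟪z.2, e⟫ := hzmem.2
    have hpos : 0 < ⟪z.2, e⟫ := hR₀.trans hxe
    have hxn : R₀ < ‖z.2‖ := lt_of_lt_of_le hxe (hinner z.2)
    have ht : z.1 < 0 := hzmem.1.2
    have hs : 0 < Real.sqrt (-z.1) := Real.sqrt_pos.2 (by linarith)
    refine (hz hpos).trans ?_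
    rcases le_or_gt K 0 with hK | hK
    · exact (div_nonpos_of_nonpos_of_nonneg hK (by positivity)).trans zero_le_one
    · rw [div_le_one (by positivity)]
      have : K ≤ R₀ := le_max_left _ _
      linarith
  have hsmall : ∀ ε : ℝ, 0 < ε → ∃ s₀ : ℝ, s₀ < 0 ∧
      ∀ᵐ z ∂(volume.restrict (Ioo s₀ 0 ×ˢ {x : E³ | R₀ < ⟪x, e⟫})), ‖w z.1 z.2‖ ≤ ε := by
    intro ε hε
    obtain ⟨η, hη, hfw⟩ := hfaintw (ε * R₀) (by positivity)
    refine ⟨-(η * R₀ ^ 2), by rw [neg_lt_zero]; positivity, ?_⟩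
    have hsub : Ioo (-(η * R₀ ^ 2)) 0 ×ˢ {x : E³ | R₀ < ⟪x, e⟫} ⊆ Iio (0 : ℝ) ×ˢ (univ : Set E³) :=
      prod_mono Ioo_subset_Iio_self (subset_univ _)
    filter_upwards [ae_restrict_of_ae_restrict_of_subset hsub hfw,
      ae_restrict_mem (measurableSet_Ioo.prod (hSm R₀))] with z hz hzmem
    have hxe : R₀ < ⟪z.2, e⟫ := hzmem.2
    have hpos : 0 < ⟪z.2, e⟫ := hR₀.trans hxe
    have hxn : R₀ < ‖z.2‖ := lt_of_lt_of_le hxe (hinner z.2)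
    have hn0 : 0 < ‖z.2‖ := hR₀.trans hxn
    have htime : -η * ‖z.2‖ ^ 2 < z.1 := by
      have h1 : -(η * R₀ ^ 2) < z.1 := hzmem.1.1
      have h2 : R₀ ^ 2 < ‖z.2‖ ^ 2 := by nlinarith
      nlinarith
    have key : ‖z.2‖ * ‖w z.1 z.2‖ ≤ ε * R₀ := hz hpos htime
    by_contra hcon
    push Not at hcon
    have : ε * R₀ < ‖z.2‖ * ‖w z.1 z.2‖ := by nlinarith
    linarith
  -- ## S3: the far-field representative; S2: its vorticity vanishes on the far half-space
  obtain ⟨Uf, Kf, hUf, hUfc, htop, hUf', hsol, hU4, hΦ, hKf⟩ :=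
    stub_halfspaceFarFieldRepresentative e he R₀ hR₀ w π H hsww hH hIw hfar hsmall
  set x₀ : E³ := (R₀ + 1) • e with hx₀def
  have hx₀e : ⟪x₀, e⟫ = R₀ + 1 := by
    rw [hx₀def, real_inner_smul_left, real_inner_self_eq_norm_sq, he]; ring
  have hx₀S : ∀ y : E³, 0 < ⟪y, e⟫ → x₀ + y ∈ {x : E³ | R₀ + 1 < ⟪x, e⟫} := by
    intro y hy
    show R₀ + 1 < ⟪x₀ + y, e⟫
    rw [inner_add_left, hx₀e]
    linarith
  have hcurl0 := stub_halfspaceFarFieldCurl {x : E³ | R₀ + 1 < ⟪x, e⟫} (hSo (R₀ + 1)) x₀ e he hx₀S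
    (fun s y => if R₀ < ⟪y, e⟫ then w s y else 0) Uf π Kf htop hUf' hsol hU4 hΦ hKf
  have hcurl : ∀ z ∈ Ioo (-1 : ℝ) 0 ×ˢ {x : E³ | R₀ + 1 + 1 < ⟪x, e⟫}, curl (Uf z.1) z.2 = 0 := by
    rintro z ⟨hz1, hz2⟩
    refine hcurl0 z ⟨hz1, ?_⟩
    show ⟪x₀, e⟫ < ⟪z.2, e⟫
    have hz2' : R₀ + 1 + 1 < ⟪z.2, e⟫ := hz2
    rw [hx₀e]
    linarith
  -- ## S4 on the strips `]-1/3, -1/(n+4)[`, the rate bounding the velocity there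
  have hstrip : ∀ n : ℕ, ∀ᵐ s ∂(volume.restrict (Ioo (-(1 / 3 : ℝ)) (-(1 / ((n : ℝ) + 4))))),
      w s =ᵐ[volume] 0 := by
    intro n
    set b : ℝ := -(1 / ((n : ℝ) + 4)) with hbdef
    have hb : b < 0 := by rw [hbdef, neg_lt_zero]; positivity
    have hbd : ∀ᵐ z ∂(volume.restrict (Ioo (-(1 / 3 : ℝ) - 4 * (1 / 4 : ℝ) ^ 2) b ×ˢ (univ : Set E³))),
        ‖w z.1 z.2‖ ≤ max C 0 / Real.sqrt (-b) := by
      have hsub : Ioo (-(1 / 3 : ℝ) - 4 * (1 / 4 : ℝ) ^ 2) b ×ˢ (univ : Set E³) ⊆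
          Iio (0 : ℝ) ×ˢ (univ : Set E³) := prod_mono (fun t ht => ht.2.trans hb) Subset.rfl
      filter_upwards [ae_restrict_of_ae_restrict_of_subset hsub hratew,
        ae_restrict_mem (measurableSet_Ioo.prod MeasurableSet.univ)] with z hz hzmem
      have ht : z.1 < b := hzmem.1.2
      have hs : 0 < Real.sqrt (-z.1) := Real.sqrt_pos.2 (by linarith)
      have hsb : 0 < Real.sqrt (-b) := Real.sqrt_pos.2 (by linarith)
      calc ‖w z.1 z.2‖ ≤ C / Real.sqrt (-z.1) := hz
        _ ≤ max C 0 / Real.sqrt (-z.1) := div_le_div_of_nonneg_right (le_max_left _ _) hs.le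
        _ ≤ max C 0 / Real.sqrt (-b) :=
            div_le_div_of_nonneg_left (le_max_right _ _) hsb (Real.sqrt_le_sqrt (by linarith))
    exact stub_halfspaceStripLiouville e he (R₀ + 1) (by positivity) w π H Uf hsww hH hIw hUf hUfc
      hcurl (-(1 / 3 : ℝ)) b (1 / 4) (max C 0 / Real.sqrt (-b)) (by norm_num) (by norm_num) hb.le hbd
  -- ## `w(s) = 0` a.e. for a.e. `s ∈ ]-1/3, 0[`
  have hae0 : ∀ᵐ s ∂(volume.restrict (Ioo (-(1 / 3 : ℝ)) 0)), w s =ᵐ[volume] 0 := by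
    have hcov : Ioo (-(1 / 3 : ℝ)) 0 ⊆ ⋃ n : ℕ, Ioo (-(1 / 3 : ℝ)) (-(1 / ((n : ℝ) + 4))) := by
      intro s hs
      obtain ⟨n, hn⟩ := exists_nat_one_div_lt (neg_pos.2 hs.2)
      refine mem_iUnion.2 ⟨n, hs.1, ?_⟩
      have h1 : 1 / ((n : ℝ) + 4) ≤ 1 / ((n : ℝ) + 1) :=
        one_div_le_one_div_of_le (by positivity) (by linarith)
      linarith
    refine ae_restrict_of_ae_restrict_of_subset hcov ?_
    rw [ae_restrict_iUnion_iff]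
    exact hstrip
  -- ## `w = 0` a.e. on `Q(0, 1/2)`: the origin is not singular
  have hQ : parabolicCylinder (1 / 2) (0 : ℝ × E³) = Ioo (-(1 / 4 : ℝ)) 0 ×ˢ ball (0 : E³) (1 / 2) := by
    rw [parabolicCylinder]
    simp only [Prod.fst_zero, Prod.snd_zero, zero_sub]
    norm_num
  have hwmQ : AEStronglyMeasurable (uncurry w)
      (volume.restrict (parabolicCylinder (1 / 2) (0 : ℝ × E³))) :=
    hH.locallyIntegrableOn.aestronglyMeasurable.mono_measure
      (Measure.restrict_mono (parabolicCylinder_subset_slab _ le_rfl) le_rfl)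
  have hzero : ∫⁻ z in parabolicCylinder (1 / 2) (0 : ℝ × E³), ‖w z.1 z.2‖ₑ = 0 := by
    have hf : AEMeasurable (fun z : ℝ × E³ => ‖w z.1 z.2‖ₑ)
        ((volume.restrict (Ioo (-(1 / 4 : ℝ)) 0)).prod (volume.restrict (ball (0 : E³) (1 / 2)))) := by
      rw [Measure.prod_restrict, ← Measure.volume_eq_prod, ← hQ]
      exact hwmQ.enorm
    rw [hQ, Measure.volume_eq_prod, ← Measure.prod_restrict, lintegral_prod _ hf]
    refine (lintegral_congr_ae ?_).trans lintegral_zero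
    filter_upwards [ae_restrict_of_ae_restrict_of_subset (Ioo_subset_Ioo (by norm_num) le_rfl) hae0] with t ht
    refine (lintegral_congr_ae ?_).trans lintegral_zero
    filter_upwards [ae_restrict_of_ae ht] with x hx
    simp [hx]
  have hae : ∀ᵐ z ∂(volume.restrict (parabolicCylinder (1 / 2) (0 : ℝ × E³))),
      uncurry w z = (0 : ℝ × E³ → E³) z := by
    have h := (lintegral_eq_zero_iff' hwmQ.enorm).1 hzero
    filter_upwards [h] with ⟨t, x⟩ hz
    have hz' : ‖w t x‖ₑ = 0 := hz
    simpa using hz'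
  have h0 : eLpNorm (uncurry w) ⊤ (volume.restrict (parabolicCylinder (1 / 2) (0 : ℝ × E³))) = 0 :=
    (eLpNorm_eq_zero_iff hwmQ ENNReal.top_ne_zero).2 hae
  have h := hsingw (1 / 2) (by norm_num)
  rw [h0] at h
  exact ENNReal.zero_ne_top h

end Summit.NavierStokesRegularity.NavierStokesRegularity.Theorems.RellichScarApexLocalisation

end
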